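import Mathlib

/-!
# PartN27 — LEMMA JF-1 (square completion) and the HESSIAN-FREE CERTIFICATE (memo ROTOR-THEORY-20 §263(h), THEOREMS M89)

Abstract layer of the cycle-20 explicit lower bound for the three-body Krein secular function
`3V²Φ = min_τ F(τ)`, `F(τ) = c + 2 Re⟨τ, ℓ⟩ + ⟨τ, Q̃ τ⟩` with `Q̃ = Q_S + B P⁻¹ Bᴴ ≥ 0` the exact dressed
shell operator.  For ANY explicit shell amplitude `τ` (in the application: the Jastrow–Feynman ray) and any
`y` solving `Q̃ y = Q̃ τ + ℓ =: r̃` (the shell residual),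

  `F(τ') ≥ F(τ) − Re⟨r̃, y⟩`  for every `τ'`        (`quadratic_lower_bound`, equality at `τ' = τ − y`),

so that a trial value `g ≤ F(τ)` (supplied by `PartN25.variational_lower_bound` with the anchored charge) and
an upper bound `Re⟨r̃, y⟩ ≤ pen` (supplied by LEMMA κ₀ and the norm chain of §263(h)) give the certificate
`g − pen ≤ F(τ')` for all `τ'`, i.e. `g − pen ≤ 3V²Φ` (`certificate_lower_bound`).  No positivity of any
TRIAL Hessian is needed — only `Q̃ ≥ 0`, which is exact.  Mathlib only; no `sorry`.
-/

-- Port of theory seat `hubbard-h0-rotor-theory-1` cycle20/lean/PartN27.lean (sha16 3b22455b9655911b) verbatim modulo this header,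
-- `set_option linter.dupNamespace false` and lint fixes; prover seat `hubbard-h0-rotor-p1` g21, `--supports stmt-HubbardSuperconductivity-19089`.

set_option linter.dupNamespace false

namespace Summit.HubbardSuperconductivity.HubbardSuperconductivity.Theorems.AnisotropyChord.Transfer.JF1

open Matrix
open scoped ComplexOrder

variable {m : Type*} [Fintype m]

/-- The shell functional in normal form: `F(τ) = c + 2 Re⟨τ, ℓ⟩ + Re⟨τ, Q̃ τ⟩`. -/
def shellF (Qt : Matrix m m ℂ) (ℓ : m → ℂ) (c : ℝ) (τ : m → ℂ) : ℝ :=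
  c + 2 * (star τ ⬝ᵥ ℓ).re + (star τ ⬝ᵥ Qt.mulVec τ).re

/-- Hermitian symmetry of the sesquilinear form: `⟨a, Q b⟩ = conj ⟨b, Q a⟩`. -/
theorem dot_mulVec_symm (Qt : Matrix m m ℂ) (hQ : Qt.IsHermitian) (a b : m → ℂ) :
    star a ⬝ᵥ Qt.mulVec b = star (star b ⬝ᵥ Qt.mulVec a) := by
  rw [Matrix.star_dotProduct, Matrix.star_mulVec, hQ.eq, Matrix.dotProduct_mulVec]

/-- Real parts agree under Hermitian symmetry. -/
theorem re_dot_mulVec_symm (Qt : Matrix m m ℂ) (hQ : Qt.IsHermitian) (a b : m → ℂ) :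
    (star a ⬝ᵥ Qt.mulVec b).re = (star b ⬝ᵥ Qt.mulVec a).re := by
  rw [dot_mulVec_symm Qt hQ a b, Complex.star_def, Complex.conj_re]

/-- **LEMMA JF-1 (square completion).**  For `Q̃ ≥ 0` and any `τ`, any `y` with `Q̃ y = Q̃ τ + ℓ` (the shell
residual `r̃`), the functional `F = shellF Q̃ ℓ c` satisfies `F τ − Re⟨r̃, y⟩ ≤ F τ'` for every `τ'`.
[theory seat hubbard-h0-rotor-theory-1, cycle 20, memo ROTOR-THEORY-20 §263(h); folklore] -/
theorem quadratic_lower_bound (Qt : Matrix m m ℂ) (hQ : Qt.PosSemidef) (ℓ : m → ℂ) (c : ℝ)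
    (τ τ' y : m → ℂ) (hy : Qt.mulVec y = Qt.mulVec τ + ℓ) :
    shellF Qt ℓ c τ - (star (Qt.mulVec τ + ℓ) ⬝ᵥ y).re ≤ shellF Qt ℓ c τ' := by
  have hH : Qt.IsHermitian := hQ.1
  set x : m → ℂ := τ' - τ with hx
  have hτ' : τ' = τ + x := by rw [hx]; abel
  -- 0 ≤ Re⟨x + y, Q̃ (x + y)⟩
  have h0 : 0 ≤ (star (x + y) ⬝ᵥ Qt.mulVec (x + y)).re :=
    (Complex.nonneg_iff.mp (hQ.dotProduct_mulVec_nonneg (x + y))).1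
  -- (A) expansion of Re⟨x + y, Q̃ (x + y)⟩
  have eA : star (x + y) ⬝ᵥ Qt.mulVec (x + y)
      = star x ⬝ᵥ Qt.mulVec x + star x ⬝ᵥ Qt.mulVec y + star y ⬝ᵥ Qt.mulVec x + star y ⬝ᵥ Qt.mulVec y := by
    rw [star_add, Matrix.mulVec_add, add_dotProduct, dotProduct_add, dotProduct_add]; ring
  have eXY : star x ⬝ᵥ Qt.mulVec y = star x ⬝ᵥ Qt.mulVec τ + star x ⬝ᵥ ℓ := by
    rw [hy, dotProduct_add]
  have eYX : (star y ⬝ᵥ Qt.mulVec x).re = (star x ⬝ᵥ Qt.mulVec y).re := re_dot_mulVec_symm Qt hH y x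
  have hA : (star (x + y) ⬝ᵥ Qt.mulVec (x + y)).re
      = (star x ⬝ᵥ Qt.mulVec x).re + 2 * (star x ⬝ᵥ Qt.mulVec τ).re + 2 * (star x ⬝ᵥ ℓ).re
        + (star y ⬝ᵥ Qt.mulVec y).re := by
    rw [eA]; simp only [Complex.add_re]; rw [eYX, eXY]; simp only [Complex.add_re]; ring
  -- (B) linear term at τ' = τ + x
  have hB : (star τ' ⬝ᵥ ℓ).re = (star τ ⬝ᵥ ℓ).re + (star x ⬝ᵥ ℓ).re := by
    rw [hτ', star_add, add_dotProduct, Complex.add_re]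
  -- (C) quadratic term at τ' = τ + x
  have eC : star (τ + x) ⬝ᵥ Qt.mulVec (τ + x)
      = star τ ⬝ᵥ Qt.mulVec τ + star τ ⬝ᵥ Qt.mulVec x + star x ⬝ᵥ Qt.mulVec τ + star x ⬝ᵥ Qt.mulVec x := by
    rw [star_add, Matrix.mulVec_add, add_dotProduct, dotProduct_add, dotProduct_add]; ring
  have eTX : (star τ ⬝ᵥ Qt.mulVec x).re = (star x ⬝ᵥ Qt.mulVec τ).re := re_dot_mulVec_symm Qt hH τ x
  have hC : (star τ' ⬝ᵥ Qt.mulVec τ').re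
      = (star τ ⬝ᵥ Qt.mulVec τ).re + 2 * (star x ⬝ᵥ Qt.mulVec τ).re + (star x ⬝ᵥ Qt.mulVec x).re := by
    rw [hτ', eC]; simp only [Complex.add_re]; rw [eTX]; ring
  -- (D) the penalty: Re⟨r̃, y⟩ = Re⟨y, Q̃ y⟩
  have hD : (star (Qt.mulVec τ + ℓ) ⬝ᵥ y).re = (star y ⬝ᵥ Qt.mulVec y).re := by
    rw [← hy, Matrix.star_mulVec, hH.eq, ← Matrix.dotProduct_mulVec]
  unfold shellF
  rw [hB, hC, hD]
  linarith [h0, hA]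

/-- **HESSIAN-FREE CERTIFICATE.**  If `g ≤ F(τ)` (a trial value, e.g. from the anchored charge via
`variational_lower_bound`) and `Re⟨r̃, y⟩ ≤ pen` (LEMMA κ₀ + the norm chain), then `g − pen ≤ F(τ')` for all
`τ'`; in particular `g − pen ≤ min_τ' F = 3V²Φ`.  [memo ROTOR-THEORY-20 §263(h)] -/
theorem certificate_lower_bound (Qt : Matrix m m ℂ) (hQ : Qt.PosSemidef) (ℓ : m → ℂ) (c g pen : ℝ)
    (τ y : m → ℂ) (hy : Qt.mulVec y = Qt.mulVec τ + ℓ) (hg : g ≤ shellF Qt ℓ c τ)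
    (hpen : (star (Qt.mulVec τ + ℓ) ⬝ᵥ y).re ≤ pen) :
    ∀ τ' : m → ℂ, g - pen ≤ shellF Qt ℓ c τ' := by
  intro τ'
  have := quadratic_lower_bound Qt hQ ℓ c τ τ' y hy
  linarith

/-- Nonnegativity of the standard Hermitian form `Re⟨v, v⟩ ≥ 0` on `m → ℂ`. -/
theorem re_star_dotProduct_self_nonneg [DecidableEq m] (v : m → ℂ) : 0 ≤ (star v ⬝ᵥ v).re := by
  have h := (Matrix.PosDef.one : (1 : Matrix m m ℂ).PosDef).posSemidef.dotProduct_mulVec_nonneg v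
  rw [Matrix.one_mulVec] at h
  exact (Complex.nonneg_iff.mp h).1

/-- The scaled-gap step of the norm chain: if `Q̃ y = r̃` and `Q̃` is coercive on `y`,
`ĝ · Re⟨y, y⟩ ≤ Re⟨y, Q̃ y⟩` with `ĝ > 0` (LEMMA κ₀ gives `ĝ ≥ (3η + m)/(3 + m)` in the `(ΔW)^{1/2}`-scaled
coordinates), then `Re⟨r̃, y⟩ = Re⟨y, Q̃ y⟩ ≤ Re⟨r̃, r̃⟩ / ĝ`.  Proof: `0 ≤ ‖r̃ − ĝ y‖²`. [folklore] -/
theorem penalty_le_of_coercive [DecidableEq m] (Qt : Matrix m m ℂ) (hH : Qt.IsHermitian) (r y : m → ℂ)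
    (hy : Qt.mulVec y = r) (ghat : ℝ) (hg : 0 < ghat)
    (hcoer : ghat * (star y ⬝ᵥ y).re ≤ (star y ⬝ᵥ Qt.mulVec y).re) :
    (star r ⬝ᵥ y).re ≤ (star r ⬝ᵥ r).re / ghat := by
  have hq : (star r ⬝ᵥ y).re = (star y ⬝ᵥ Qt.mulVec y).re := by
    rw [← hy, Matrix.star_mulVec, hH.eq, ← Matrix.dotProduct_mulVec]
  have h0 : 0 ≤ (star (r - (ghat : ℂ) • y) ⬝ᵥ (r - (ghat : ℂ) • y)).re :=
    re_star_dotProduct_self_nonneg _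
  have e0 : star (r - (ghat : ℂ) • y) ⬝ᵥ (r - (ghat : ℂ) • y)
      = star r ⬝ᵥ r - (ghat : ℂ) * (star r ⬝ᵥ y) - (ghat : ℂ) * (star y ⬝ᵥ r)
        + ((ghat * ghat : ℝ) : ℂ) * (star y ⬝ᵥ y) := by
    have hs : star ((ghat : ℂ) • y) = (ghat : ℂ) • star y := by
      rw [star_smul, Complex.star_def, Complex.conj_ofReal]
    rw [star_sub, hs, sub_dotProduct, dotProduct_sub, dotProduct_sub]
    simp only [smul_dotProduct, dotProduct_smul, smul_eq_mul]
    push_cast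
    ring
  have eyr : (star y ⬝ᵥ r).re = (star r ⬝ᵥ y).re := by
    have : star y ⬝ᵥ r = star (star r ⬝ᵥ y) := by
      rw [← Matrix.star_dotProduct_star, star_star]
    rw [this, Complex.star_def, Complex.conj_re]
  have h1 : (star (r - (ghat : ℂ) • y) ⬝ᵥ (r - (ghat : ℂ) • y)).re
      = (star r ⬝ᵥ r).re - 2 * ghat * (star r ⬝ᵥ y).re + ghat * ghat * (star y ⬝ᵥ y).re := by
    rw [e0]; simp only [Complex.sub_re, Complex.add_re, Complex.re_ofReal_mul]; rw [eyr]; ring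
  rw [h1] at h0
  -- h0 : 0 ≤ ‖r‖² − 2ĝ q + ĝ² ‖y‖²,  hcoer : ĝ ‖y‖² ≤ q,  hq : Re⟨r,y⟩ = q  ⇒  ĝ q ≤ ‖r‖²
  rw [le_div_iff₀ hg]
  have hyy : 0 ≤ (star y ⬝ᵥ y).re := re_star_dotProduct_self_nonneg y
  nlinarith [h0, hcoer, hq, hyy, hg]

end Summit.HubbardSuperconductivity.HubbardSuperconductivity.Theorems.AnisotropyChord.Transfer.JF1
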